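import Literature.Topology.FourManifolds.TracePolarTrace
import Literature.Topology.FourManifolds.MilnorBoxTwist
import Literature.Topology.FourManifolds.MilnorFlowSymmetry
import Mathlib.Geometry.Euclidean.Inversion.Basic
import HarnessLib

/-!
# Twisting the boxes at the image saddles: reflections and inversions of the flow-polar charts

Topic `Literature/Topology/FourManifolds` (support file for the Torelli half of Griffiths'
handlebody theorem, `stmt-SmoothPoincare4-15190`, after `TracePolarTrace.lean`,
`MilnorBoxTwist.lean`).  Everything here is **proved**; the definitions are explicit
symmetries and the re-chosen saddle data.

Milnor, *Lectures on the h-cobordism theorem* (1965), Def. 3.1 (2): Milnor coordinates at a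
critical point are unique only up to the linear isometries commuting with the model field; for
index `1` in dimension `3` these contain the sign changes `(x₁; y₁, y₂) ↦ (±x₁; y₁, ±y₂)`.
Re-choosing the `B`-boxes of saddle data `Q` (`PairSaddles.lean`) by such sign changes
(`MilnorBox.twist`, `MilnorBoxTwist.lean`) changes the flow-polar charts of
`TracePolarChart.lean` by explicit planar maps:

* `TracePolar.signDiag σ` — the diagonal sign isometry of `ℝᵐ`; it commutes with every model
  field (`signDiag_milnorModelField`);
* `TracePolar.planeSym a b` — the planar map induced on flow-polar coordinates by the sign change
  `boxSign a b = signDiag (!a; true, !b)` of `ℝ³`: the inversion in the unit circle if `a`, composed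
  with the reflection `(w₀, w₁) ↦ (w₀, -w₁)` if `b` (`hypPoint_planeSym`); an involution
  preserving the flow-polar target and `x₁(w)²`;
* `SaddleData.twistB Q a b` — the saddle data with every `B`-box `DB s'` twisted by
  `boxSign (a s') (b s')`; its `A`-side is that of `Q`, and on the `B`-side
  `polW`, `pol` are precomposed with `planeSym` (`twistB_swap_pol`), the sources are unchanged
  (`twistB_swap_polSource`) and `polInv` is postcomposed with `planeSym` (`twistB_swap_polInv`).

## References

* J. Milnor, *Lectures on the h-cobordism theorem* (1965), Def. 3.1 (2) (PDF p. 12).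
  [MilnorHCobordism1965]
* H. B. Griffiths, *Automorphisms of a 3-dimensional handlebody*, Abh. Math. Sem. Univ. Hamburg
  26 (1964), §3. [GriffithsHB1964Handlebody]
-/

open scoped Manifold ContDiff Topology
open Set Function Filter Metric

noncomputable section

namespace Literature.Topology.FourManifolds

open Cobordism FourManifolds.Flow

universe u

namespace TracePolar

/-- Local notation for the model plane and space. -/
local notation "E2" => EuclideanSpace ℝ (Fin 2)
local notation "E3" => EuclideanSpace ℝ (Fin 3)

/-! ### Diagonal sign isometries -/

/-- `(±1)² = 1` for the tree's `boolSign` (`SaddleModel.lean`). [folklore] -/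
@[simp] theorem boolSign_sq (b : Bool) : boolSign b ^ 2 = 1 := by rw [sq, boolSign_mul_self]

/-- **The diagonal sign isometry** `u ↦ (± u_i)_i` of `ℝᵐ` attached to `σ : Fin m → Bool`
(`σ i = false`: flip the `i`-th coordinate; signs `boolSign` of `SaddleModel.lean`). [cite: MilnorHCobordism1965, Def. 3.1 (2) (PDF p. 12)] -/
def signDiag {m : ℕ} (σ : Fin m → Bool) : EuclideanSpace ℝ (Fin m) ≃ₗᵢ[ℝ] EuclideanSpace ℝ (Fin m) where
  toFun u := WithLp.toLp 2 fun i => boolSign (σ i) * u i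
  invFun u := WithLp.toLp 2 fun i => boolSign (σ i) * u i
  map_add' u v := by ext i; simp [mul_add]
  map_smul' c u := by ext i; simp; ring
  left_inv u := by ext i; simp [← mul_assoc, boolSign_mul_self]
  right_inv u := by ext i; simp [← mul_assoc, boolSign_mul_self]
  norm_map' u := by
    have h : ‖(WithLp.toLp 2 fun i => boolSign (σ i) * u i : EuclideanSpace ℝ (Fin m))‖ ^ 2 = ‖u‖ ^ 2 := by
      rw [EuclideanSpace.real_norm_sq_eq, EuclideanSpace.real_norm_sq_eq]
      refine Finset.sum_congr rfl fun i _ => ?_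
      simp [mul_pow]
    change ‖(WithLp.toLp 2 fun i => boolSign (σ i) * u i : EuclideanSpace ℝ (Fin m))‖ = ‖u‖
    rw [← Real.sqrt_sq (norm_nonneg _), h, Real.sqrt_sq (norm_nonneg _)]

/-- Coordinates of the sign isometry. [folklore] -/
@[simp] theorem signDiag_apply {m : ℕ} (σ : Fin m → Bool) (u : EuclideanSpace ℝ (Fin m)) (i : Fin m) :
    signDiag σ u i = boolSign (σ i) * u i := rfl

/-- The sign isometry is an involution. [folklore] -/
@[simp] theorem signDiag_signDiag {m : ℕ} (σ : Fin m → Bool) (u : EuclideanSpace ℝ (Fin m)) :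
    signDiag σ (signDiag σ u) = u := by ext i; simp [← mul_assoc, boolSign_mul_self]

/-- The inverse of the sign isometry is itself. [folklore] -/
theorem signDiag_symm_apply {m : ℕ} (σ : Fin m → Bool) (u : EuclideanSpace ℝ (Fin m)) :
    (signDiag σ).symm u = signDiag σ u :=
  (signDiag σ).injective (by rw [LinearIsometryEquiv.apply_symm_apply, signDiag_signDiag])

/-- **Sign isometries commute with every model field** (both are diagonal). [cite: MilnorHCobordism1965, Def. 3.1 (2) (PDF p. 12)] -/
theorem signDiag_milnorModelField {m : ℕ} (σ : Fin m → Bool) (k : ℕ) (u : EuclideanSpace ℝ (Fin m)) :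
    signDiag σ (milnorModelField k u) = milnorModelField k (signDiag σ u) := by
  ext i; simp

/-! ### The sign changes of the index-one model in dimension three and their planar action -/

/-- The sign change `(x₁; y₁, y₂) ↦ (±x₁; y₁, ±y₂)` of `ℝ³` (`a`: flip `x₁`; `b`: flip `y₂`). [cite: MilnorHCobordism1965, Def. 3.1 (2) (PDF p. 12)] -/
def boxSign (a b : Bool) : E3 ≃ₗᵢ[ℝ] E3 := signDiag ![!a, true, !b]

/-- `boxSign_apply_zero`. [folklore] -/
@[simp] theorem boxSign_apply_zero (a b : Bool) (u : E3) : boxSign a b u 0 = boolSign (!a) * u 0 := rfl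
/-- `boxSign_apply_one`. [folklore] -/
@[simp] theorem boxSign_apply_one (a b : Bool) (u : E3) : boxSign a b u 1 = u 1 := by
  show boolSign true * u 1 = u 1; simp
/-- `boxSign_apply_two`. [folklore] -/
@[simp] theorem boxSign_apply_two (a b : Bool) (u : E3) : boxSign a b u 2 = boolSign (!b) * u 2 := rfl

/-- `boxSign` commutes with the model field of index `1`. [folklore] -/
theorem boxSign_milnorModelField (a b : Bool) (u : E3) : boxSign a b (milnorModelField 1 u) = milnorModelField 1 (boxSign a b u) :=
  signDiag_milnorModelField _ 1 u

/-- `boxSign` is an involution. [folklore] -/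
@[simp] theorem boxSign_boxSign (a b : Bool) (u : E3) : boxSign a b (boxSign a b u) = u := signDiag_signDiag _ u

/-- `boxSign_symm_apply`. [folklore] -/
theorem boxSign_symm_apply (a b : Bool) (u : E3) : (boxSign a b).symm u = boxSign a b u := signDiag_symm_apply _ u

/-- **The planar reflection** `(w₀, w₁) ↦ (w₀, ± w₁)`. [folklore] -/
def planeRefl (b : Bool) (w : E2) : E2 := signDiag ![true, !b] w

/-- `planeRefl_apply_zero`. [folklore] -/
@[simp] theorem planeRefl_apply_zero (b : Bool) (w : E2) : planeRefl b w 0 = w 0 := by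
  show boolSign true * w 0 = w 0; simp
/-- `planeRefl_apply_one`. [folklore] -/
@[simp] theorem planeRefl_apply_one (b : Bool) (w : E2) : planeRefl b w 1 = boolSign (!b) * w 1 := rfl

/-- `norm_planeRefl`. [folklore] -/
@[simp] theorem norm_planeRefl (b : Bool) (w : E2) : ‖planeRefl b w‖ = ‖w‖ := (signDiag ![true, !b]).norm_map w

/-- `planeRefl_planeRefl`. [folklore] -/
@[simp] theorem planeRefl_planeRefl (b : Bool) (w : E2) : planeRefl b (planeRefl b w) = w := signDiag_signDiag _ w

/-- `planeRefl_smul`. [folklore] -/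
theorem planeRefl_smul (b : Bool) (c : ℝ) (w : E2) : planeRefl b (c • w) = c • planeRefl b w :=
  (signDiag ![true, !b]).map_smul c w

/-- **The planar inversion** `w ↦ w / ‖w‖²` if `a`, the identity if not (Mathlib's
`EuclideanGeometry.inversion 0 1`). [folklore] -/
def planeInv (a : Bool) (w : E2) : E2 := if a then EuclideanGeometry.inversion (0 : E2) 1 w else w

/-- The inversion in coordinates-free form. [folklore] -/
theorem inversion_zero_one (w : E2) : EuclideanGeometry.inversion (0 : E2) 1 w = (‖w‖ ^ 2)⁻¹ • w := by
  rw [EuclideanGeometry.inversion, dist_zero_right, vsub_eq_sub, sub_zero, vadd_eq_add, add_zero, one_div, inv_pow]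

/-- `planeInv` as a scalar multiple: `planeInv a w = c • w` with `c = ‖w‖⁻²` or `1`. [folklore] -/
theorem planeInv_eq_smul (a : Bool) (w : E2) : planeInv a w = (if a then (‖w‖ ^ 2)⁻¹ else 1) • w := by
  cases a <;> simp [planeInv, inversion_zero_one]

/-- `norm_planeInv`: `‖w‖⁻¹` or `‖w‖` (`w ≠ 0`). [folklore] -/
theorem norm_planeInv (a : Bool) {w : E2} (hw : w ≠ 0) : ‖planeInv a w‖ = if a then ‖w‖⁻¹ else ‖w‖ := by
  have h : ‖w‖ ≠ 0 := norm_ne_zero_iff.2 hw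
  cases a
  · simp [planeInv]
  · simp only [planeInv, if_true, inversion_zero_one, norm_smul, norm_inv, norm_pow, Real.norm_eq_abs, abs_norm]
    field_simp

/-- `planeInv` is an involution. [folklore] -/
theorem planeInv_planeInv (a : Bool) (w : E2) : planeInv a (planeInv a w) = w := by
  cases a
  · rfl
  · simp only [planeInv, if_true]
    exact EuclideanGeometry.inversion_inversion (0 : E2) one_ne_zero w

/-- `planeInv` fixes the unit circle pointwise. [folklore] -/
theorem planeInv_of_norm_eq_one (a : Bool) {w : E2} (hw : ‖w‖ = 1) : planeInv a w = w := by
  cases a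
  · rfl
  · simp [planeInv, inversion_zero_one, hw]

/-- `planeInv` does not vanish off the origin. [folklore] -/
theorem planeInv_ne_zero (a : Bool) {w : E2} (hw : w ≠ 0) : planeInv a w ≠ 0 := by
  rw [← norm_pos_iff, norm_planeInv a hw]
  have := norm_pos_iff.2 hw
  split_ifs <;> positivity

/-- **The planar symmetry induced by `boxSign a b`**: reflect if `b`, then invert if `a`. [folklore] -/
def planeSym (a b : Bool) (w : E2) : E2 := planeInv a (planeRefl b w)

/-- `planeSym_def`. [folklore] -/
theorem planeSym_def (a b : Bool) (w : E2) : planeSym a b w = planeInv a (planeRefl b w) := rfl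

/-- `planeRefl` does not vanish off the origin. [folklore] -/
theorem planeRefl_ne_zero (b : Bool) {w : E2} (hw : w ≠ 0) : planeRefl b w ≠ 0 := by
  rw [← norm_pos_iff, norm_planeRefl]; exact norm_pos_iff.2 hw

/-- `planeSym` does not vanish off the origin. [folklore] -/
theorem planeSym_ne_zero (a b : Bool) {w : E2} (hw : w ≠ 0) : planeSym a b w ≠ 0 :=
  planeInv_ne_zero a (planeRefl_ne_zero b hw)

/-- `planeInv` and `planeRefl` commute. [folklore] -/
theorem planeInv_planeRefl (a b : Bool) (w : E2) : planeInv a (planeRefl b w) = planeRefl b (planeInv a w) := by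
  rw [planeInv_eq_smul, planeInv_eq_smul, norm_planeRefl, planeRefl_smul]

/-- **`planeSym` is an involution.** [folklore] -/
theorem planeSym_planeSym (a b : Bool) (w : E2) : planeSym a b (planeSym a b w) = w := by
  rw [planeSym_def, planeSym_def, planeInv_planeRefl a b w, planeRefl_planeRefl, planeInv_planeInv]

/-- `planeSym` fixes the unit circle pointwise when `b = false`. [folklore] -/
theorem planeSym_false_of_norm_eq_one (a : Bool) {w : E2} (hw : ‖w‖ = 1) : planeSym a false w = w := by
  rw [planeSym, show planeRefl false w = w from by ext i; fin_cases i <;> simp [planeRefl]]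
  exact planeInv_of_norm_eq_one a hw

/-- The norm of `planeSym a b w`: `‖w‖⁻¹` or `‖w‖`. [folklore] -/
theorem norm_planeSym (a b : Bool) {w : E2} (hw : w ≠ 0) : ‖planeSym a b w‖ = if a then ‖w‖⁻¹ else ‖w‖ := by
  rw [planeSym, norm_planeInv a (planeRefl_ne_zero b hw), norm_planeRefl]

/-- **`x₁` changes sign under the inversion and is unchanged under the reflection.** [folklore] -/
theorem xco_planeSym {ε : ℝ} (a b : Bool) {w : E2} (hw : w ≠ 0) : xco ε (planeSym a b w) = boolSign (!a) * xco ε w := by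
  have hr : ‖w‖ ≠ 0 := norm_ne_zero_iff.2 hw
  rw [xco, xco, norm_planeSym a b hw]
  cases a
  · simp
  · simp only [if_true, inv_inv, Bool.not_true, boolSign_false]
    ring

/-- `xco_planeSym_sq`. [folklore] -/
theorem xco_planeSym_sq {ε : ℝ} (a b : Bool) {w : E2} (hw : w ≠ 0) : xco ε (planeSym a b w) ^ 2 = xco ε w ^ 2 := by
  rw [xco_planeSym a b hw, mul_pow, boolSign_sq, one_mul]

/-- `boxSign` on an assembled point: flip `x₁`, reflect `y⃗`. [folklore] -/
theorem boxSign_mk3 (a b : Bool) (x : ℝ) (y : E2) : boxSign a b (mk3 x y) = mk3 (boolSign (!a) * x) (planeRefl b y) := by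
  ext i
  fin_cases i
  · rfl
  · show boolSign true * y 0 = (planeRefl b y) 0
    rw [planeRefl_apply_zero, boolSign_true, one_mul]
  · rfl

/-- `hypPoint` as an assembled point. [folklore] -/
theorem hypPoint_eq_mk3 (ε : ℝ) (w : E2) : hypPoint ε w = mk3 (xco ε w) (yfac ε w • w) := rfl

/-- **The flow-polar point of the transformed coordinates is the sign change of the flow-polar
point**: `hypPoint ε (planeSym a b w) = boxSign a b (hypPoint ε w)` (`w ≠ 0`). [cite: MilnorHCobordism1965, Def. 3.1 (2)] -/
theorem hypPoint_planeSym {ε : ℝ} (a b : Bool) {w : E2} (hw : w ≠ 0) :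
    hypPoint ε (planeSym a b w) = boxSign a b (hypPoint ε w) := by
  have hr : 0 < ‖w‖ := norm_pos_iff.2 hw
  have hne : ‖w‖ ≠ 0 := hr.ne'
  -- `planeSym w = c • planeRefl b w`
  have hps : planeSym a b w = (if a then (‖w‖ ^ 2)⁻¹ else 1) • planeRefl b w := by
    rw [planeSym_def, planeInv_eq_smul, norm_planeRefl]
  -- the `y⃗`-factor: `yfac (planeSym w) • planeSym w = planeRefl b (yfac w • w)`
  have hy : yfac ε (planeSym a b w) • planeSym a b w = planeRefl b (yfac ε w • w) := by
    rw [planeRefl_smul, hps, smul_smul]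
    congr 1
    simp only [yfac, norm_smul, norm_planeRefl, Real.norm_eq_abs]
    cases a
    · simp
    · simp only [if_true, abs_inv, abs_pow, abs_norm]
      field_simp
      ring
  rw [hypPoint_eq_mk3, hypPoint_eq_mk3, boxSign_mk3, xco_planeSym a b hw, hy]

end TracePolar

/-! ### Twisting the `B`-boxes of saddle data -/

namespace BasinPair

namespace SaddleData

open TracePolar

variable {W : Type u} [TopologicalSpace W] [T2Space W] [SecondCountableTopology W]
  [CompactSpace W] [ChartedSpace (EuclideanHalfSpace (2 + 1)) W] [IsManifold (𝓡∂ (2 + 1)) ∞ W]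
  {g : W → ℝ} {ξA ξB : Π x : W, TangentSpace (𝓡∂ (2 + 1)) x} {P : BasinPair g ξA ξB}
  (Q : P.SaddleData)

/-- Local notation for the model plane. -/
local notation "E2" => EuclideanSpace ℝ (Fin 2)

/-- The interiority hypothesis of `MilnorBox.twist` for the `B`-boxes. [folklore] -/
theorem intB' (s' : SaddlePt 2 g) :
    closedBall ((Q.DB s').chart.extend (𝓡∂ (2 + 1)) s'.1) (3 * (Q.DB s').ε) ⊆ interior (range (𝓡∂ (2 + 1))) := by
  rw [Q.εB]; exact Q.intB s'

/-- The symmetry hypothesis of `MilnorBox.twist` for the sign changes. [folklore] -/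
theorem hSB (a b : SaddlePt 2 g → Bool) (s' : SaddlePt 2 g) (u : EuclideanSpace ℝ (Fin 3)) :
    boxSign (a s') (b s') (milnorModelField (Q.DB s').k u) = milnorModelField (Q.DB s').k (boxSign (a s') (b s') u) :=
  signDiag_milnorModelField _ _ u

/-- **Saddle data with the `B`-boxes twisted by sign changes** `boxSign (a s') (b s')`. [cite: MilnorHCobordism1965, Def. 3.1 (2) (PDF p. 12)] -/
def twistB (a b : SaddlePt 2 g → Bool) : P.SaddleData where
  c := Q.c
  apply_eq_c := Q.apply_eq_c
  ε := Q.ε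
  ε_pos := Q.ε_pos
  DA := Q.DA
  DB s' := (Q.DB s').twist (boxSign (a s') (b s')) (Q.intB' s') (Q.hSB a b s')
  εA := Q.εA
  εB s' := by rw [MilnorBox.twist_ε]; exact Q.εB s'
  σ := Q.σ
  k_eq s := by rw [MilnorBox.twist_k]; exact Q.k_eq s
  sph_lt := Q.sph_lt
  lt_collar := Q.lt_collar
  intA := Q.intA
  intB s' := by rw [MilnorBox.center_twist]; exact Q.intB s'
  disjA := Q.disjA
  disjB s₁ s₂ h := (Q.disjB s₁ s₂ h).mono (MilnorBox.twistChart_source_subset _ _) (MilnorBox.twistChart_source_subset _ _)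

variable (a b : SaddlePt 2 g → Bool)

/-- `twistB_DA`. [folklore] -/
@[simp] theorem twistB_DA : (Q.twistB a b).DA = Q.DA := rfl
/-- `twistB_σ`. [folklore] -/
@[simp] theorem twistB_σ : (Q.twistB a b).σ = Q.σ := rfl
/-- `twistB_ε`. [folklore] -/
@[simp] theorem twistB_ε : (Q.twistB a b).ε = Q.ε := rfl
/-- `twistB_c`. [folklore] -/
@[simp] theorem twistB_c : (Q.twistB a b).c = Q.c := rfl
/-- `twistB_DB`. [folklore] -/
theorem twistB_DB (s' : SaddlePt 2 g) : (Q.twistB a b).DB s' =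
    (Q.DB s').twist (boxSign (a s') (b s')) (Q.intB' s') (Q.hSB a b s') := rfl

/-- The index of the twisted `B`-boxes. [folklore] -/
@[simp] theorem twistB_DB_k (s' : SaddlePt 2 g) : ((Q.twistB a b).DB s').k = (Q.DB s').k := rfl

/-- The coordinates of the twisted `B`-boxes on their sources. [folklore] -/
theorem coord_twistB_DB {s' : SaddlePt 2 g} {z : W} (hz : z ∈ ((Q.twistB a b).DB s').chart.source) :
    ((Q.twistB a b).DB s').coord z = boxSign (a s') (b s') ((Q.DB s').coord z) :=
  MilnorBox.coord_twist (Q.DB s') _ (Q.intB' s') (Q.hSB a b s') hz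
/-- The `A`-side flow-polar points are unchanged. [folklore] -/
@[simp] theorem twistB_polW (s : SaddlePt 2 g) (w : E2) : (Q.twistB a b).polW s w = Q.polW s w := rfl
/-- The flow-polar target is unchanged. [folklore] -/
@[simp] theorem twistB_polTarget : (Q.twistB a b).polTarget = Q.polTarget := rfl
/-- `twistB_swap_polTarget`. [folklore] -/
@[simp] theorem twistB_swap_polTarget : (Q.twistB a b).swap.polTarget = Q.swap.polTarget := rfl
/-- `twistB_exitLevel`. [folklore] -/
@[simp] theorem twistB_exitLevel : (Q.twistB a b).exitLevel = Q.exitLevel := rfl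

variable {Q a b}

/-- `planeSym` preserves the flow-polar target. [folklore] -/
theorem planeSym_mem_polTarget (a' b' : Bool) {w : E2} (hw : w ∈ Q.polTarget) : planeSym a' b' w ∈ Q.polTarget :=
  ⟨planeSym_ne_zero a' b' hw.1, by rw [xco_planeSym_sq a' b' hw.1]; exact hw.2⟩

/-- **The `B`-side flow-polar points of the twisted data are those of `Q` at the transformed
coordinates**: `polW'_{tw} s' w = polW' s' (planeSym w)` (`w` in the target). [cite: MilnorHCobordism1965, Def. 3.1 (2)] -/
theorem twistB_swap_polW {s' : SaddlePt 2 g} {w : E2} (hw : w ∈ Q.polTarget) :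
    (Q.twistB a b).swap.polW s' w = Q.swap.polW s' (planeSym (a s') (b s') w) := by
  have hn : ‖hypPoint Q.ε w‖ ≤ 3 * (Q.DB s').ε := by
    rw [Q.εB]; exact (norm_hypPoint_lt Q.ε_pos hw.1 hw.2).le
  show (((Q.twistB a b).DB s').chart.extend (𝓡∂ (2 + 1))).symm (((Q.twistB a b).DB s').center + hypPoint Q.ε w) =
    ((Q.DB s').chart.extend (𝓡∂ (2 + 1))).symm ((Q.DB s').center + hypPoint Q.ε (planeSym (a s') (b s') w))
  rw [twistB_DB, MilnorBox.center, MilnorBox.twist_symm_add (Q.DB s') _ (Q.intB' s') (Q.hSB a b s') hn, boxSign_symm_apply,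
    ← hypPoint_planeSym _ _ hw.1]

variable [Nonempty (BoundaryManifold.boundaryData 2 W).carrier]

/-- **The `B`-side flow-polar charts of the twisted data**: `pol'_{tw} s' = pol' s' ∘ planeSym` on the target. [cite: GriffithsHB1964Handlebody, §3] -/
theorem twistB_swap_pol {s' : SaddlePt 2 g} {w : E2} (hw : w ∈ Q.polTarget) :
    (Q.twistB a b).swap.pol s' w = Q.swap.pol s' (planeSym (a s') (b s') w) := by
  show P.B.bret (P.B.top ((Q.twistB a b).swap.polW s' w)) = P.B.bret (P.B.top (Q.swap.polW s' (planeSym (a s') (b s') w)))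
  rw [twistB_swap_polW hw]

omit [Nonempty (BoundaryManifold.boundaryData 2 W).carrier] in
/-- The `3ε`-chart balls of the twisted `B`-boxes are those of the old ones, and the twisted
coordinates are the sign change of the old ones there. [folklore] -/
theorem mem_chartBall_twistB_iff {s' : SaddlePt 2 g} {z : W} :
    z ∈ ((Q.twistB a b).DB s').chartBall (3 * Q.ε) ↔ z ∈ (Q.DB s').chartBall (3 * Q.ε) := by
  have hε : (Q.DB s').ε = Q.ε := Q.εB s'
  constructor
  · rintro ⟨hz, hn⟩
    refine ⟨MilnorBox.twistChart_source_subset _ _ hz, ?_⟩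
    rw [Q.coord_twistB_DB a b hz, LinearIsometryEquiv.norm_map] at hn; exact hn
  · rintro ⟨hz, hn⟩
    have h1 : ((Q.DB s').chart.extend (𝓡∂ (2 + 1))).symm ((Q.DB s').center + (Q.DB s').coord z) ∈ ((Q.twistB a b).DB s').chart.source :=
      MilnorBox.symm_add_mem_twist_source (Q.DB s') _ (Q.intB' s') (Q.hSB a b s') (by rw [hε]; exact hn.le)
    rw [(Q.DB s').symm_add_coord hz] at h1
    refine ⟨h1, ?_⟩
    rw [Q.coord_twistB_DB a b h1, LinearIsometryEquiv.norm_map]; exact hn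

omit [Nonempty (BoundaryManifold.boundaryData 2 W).carrier] in
/-- **The exit sets of the twisted `B`-boxes are those of the old ones.** [folklore] -/
theorem twistB_swap_Uexit (s' : SaddlePt 2 g) (δ : ℝ) : (Q.twistB a b).swap.Uexit s' δ = Q.swap.Uexit s' δ := by
  ext z
  show z ∈ ((Q.twistB a b).DB s').chartBall (3 * Q.ε) ∧ sqSumLT ((Q.twistB a b).DB s').k (((Q.twistB a b).DB s').coord z) < δ ↔
    z ∈ (Q.DB s').chartBall (3 * Q.ε) ∧ sqSumLT (Q.DB s').k ((Q.DB s').coord z) < δ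
  rw [mem_chartBall_twistB_iff]
  constructor
  · rintro ⟨hz, hA⟩
    refine ⟨hz, ?_⟩
    have hz' : z ∈ ((Q.twistB a b).DB s').chart.source := (mem_chartBall_twistB_iff.2 hz).1
    rw [Q.coord_twistB_DB a b hz', twistB_DB_k, sqSumLT_map_of_comm _ (Q.hSB a b s')] at hA
    exact hA
  · rintro ⟨hz, hA⟩
    refine ⟨hz, ?_⟩
    have hz' : z ∈ ((Q.twistB a b).DB s').chart.source := (mem_chartBall_twistB_iff.2 hz).1
    rw [Q.coord_twistB_DB a b hz', twistB_DB_k, sqSumLT_map_of_comm _ (Q.hSB a b s')]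
    exact hA

omit [Nonempty (BoundaryManifold.boundaryData 2 W).carrier] in
/-- **The sources of the `B`-side flow-polar charts are unchanged by the twist.** [folklore] -/
@[simp] theorem twistB_swap_polSource (s' : SaddlePt 2 g) : (Q.twistB a b).swap.polSource s' = Q.swap.polSource s' := by
  ext y
  show (Q.twistB a b).swap.Zpt y ∈ (Q.twistB a b).swap.Uexit s' ((Q.twistB a b).swap.ε ^ 2) ↔ Q.swap.Zpt y ∈ Q.swap.Uexit s' (Q.swap.ε ^ 2)
  rw [twistB_swap_Uexit]; rfl

/-- **The `B`-side flow-polar coordinates of the twisted data are the transformed coordinates**: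
`polInv'_{tw} s' = planeSym ∘ polInv' s'` on the source (index `1`). [cite: GriffithsHB1964Handlebody, §3] -/
theorem twistB_swap_polInv {s' : SaddlePt 2 g} (hk' : (Q.swap.DA s').k = 1) {y : (𝓡∂ (2 + 1)).boundary W}
    (hy : y ∈ Q.swap.polSource s') : (Q.twistB a b).swap.polInv s' y = planeSym (a s') (b s') (Q.swap.polInv s' y) := by
  have hkt : ((Q.twistB a b).swap.DA s').k = 1 := by
    show ((Q.twistB a b).DB s').k = 1; rw [twistB_DB, MilnorBox.twist_k]; exact hk'
  have hy' : y ∈ (Q.twistB a b).swap.polSource s' := by rw [twistB_swap_polSource]; exact hy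
  -- both sides lie in the target and have the same image under the twisted chart
  have h1 : (Q.twistB a b).swap.polInv s' y ∈ Q.polTarget := polInv_mem_polTarget hkt hy'
  have h0 : Q.swap.polInv s' y ∈ Q.polTarget := polInv_mem_polTarget hk' hy
  have h2 : planeSym (a s') (b s') (Q.swap.polInv s' y) ∈ Q.polTarget := planeSym_mem_polTarget _ _ h0
  have h3 : (Q.twistB a b).swap.pol s' ((Q.twistB a b).swap.polInv s' y) = y := pol_polInv hkt hy'
  have h4 : (Q.twistB a b).swap.pol s' (planeSym (a s') (b s') (Q.swap.polInv s' y)) = y := by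
    rw [twistB_swap_pol h2, planeSym_planeSym, pol_polInv hk' hy]
  -- the twisted chart is injective on the target
  have hinj : InjOn ((Q.twistB a b).swap.pol s') Q.polTarget := fun w₁ hw₁ w₂ hw₂ h => by
    have := congrArg ((Q.twistB a b).swap.polInv s') h
    rwa [polInv_pol hkt hw₁, polInv_pol hkt hw₂] at this
  exact hinj h1 h2 (h3.trans h4.symm)

end SaddleData

end BasinPair

end Literature.Topology.FourManifolds
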